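import Summits.QuantumFields.YangMills.Theorems.BrascampLiebVacuum.Negative.WilsonTorusToolkit

/-!
# `ConvexGribovBody.BrascampLiebVacuum` — boundary lemma: the trivial volume bound on the
Coulomb covariance scale `Dmax` (refuter, crux stmt-QuantumFields-8779)

`Dmax(β, S) = sup_p ∫ sup_{h ∈ argmin coul(U,·)} cov(U, h, p) dμ` is the constant side of the crux
`Summit.QuantumFields.YangMills.Theses.ConvexGribovBody.BrascampLiebVacuum`. This file proves the
only UNCONDITIONAL upper bound available, `Dmax ≤ 3 N (2S+1)³` (`dmax_le_volume`): each
minimal-Coulomb-gauge link field `A_j(y) = ½(ρ(V) − ρ(V)ᴴ)` has Frobenius norm `≤ √N`, the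
Fourier sum over the `(2S+1)³` sites of the slice has norm `≤ (2S+1)³ √N`, so
`cov ≤ 3 (2S+1)⁶ N / (2S+1)³`. No measurability or argmin-existence is needed (Lean's `⨆` and `∫`
junk values are `0 ≤` the bound).

Why it is recorded (Disproof.lean, finding F0): to refute the crux one must beat
`C · Dmax(β, S)` for infinitely many `S ≥ S₀(β)` at a fixed `β`; with this bound a test-function
family would need `Var/dir ≫ S³`, i.e. a slow mode whose Poincaré ratio GROWS WITH THE VOLUME at
fixed weak coupling (phase coexistence), which Wilson's theory is not expected to have. Every
bounded-in-`S` obstruction (local traps, `e^{bβ}`) is absorbed by `S₀(β)` unless an `S`-uniform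
bound on `Dmax` — a quantitative `CovarianceBound` — is proved first.
-/

noncomputable section

open scoped BigOperators Topology Matrix Matrix.Norms.Frobenius
open Filter MeasureTheory
open Literature.MathematicalPhysics.QuantumFieldTheory

namespace Summit.QuantumFields.YangMills.Theorems.BrascampLiebVacuum.Negative

section Volume

variable {G : Type*} [Group G] [TopologicalSpace G] [IsTopologicalGroup G] [CompactSpace G]
  [MeasurableSpace G] [BorelSpace G]

omit [IsTopologicalGroup G] [CompactSpace G] [MeasurableSpace G] [BorelSpace G] in
/-- The anti-Hermitian part of a represented group element has Frobenius norm `≤ √N`. [folklore] -/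
theorem norm_antiHermitianPart_le (r : LatticeRep G) (g : G) :
    ‖(1 / 2 : ℂ) • (r.ρ g - (r.ρ g)ᴴ)‖ ≤ Real.sqrt r.N := by
  have hu : ‖r.ρ g‖ = Real.sqrt r.N := by
    have h := WilsonWeakCoupling.norm_coe_sq (⟨r.ρ g, r.mem_unitary g⟩ : UnitaryCayley.𝔾 r.N)
    simp only at h
    rw [← h, Real.sqrt_sq (norm_nonneg _)]
  calc ‖(1 / 2 : ℂ) • (r.ρ g - (r.ρ g)ᴴ)‖ = (1 / 2) * ‖r.ρ g - (r.ρ g)ᴴ‖ := by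
        rw [norm_smul]; norm_num
    _ ≤ (1 / 2) * (‖r.ρ g‖ + ‖(r.ρ g)ᴴ‖) := by gcongr; exact norm_sub_le _ _
    _ = Real.sqrt r.N := by rw [Matrix.frobenius_norm_conjTranspose, hu]; ring

/-- The lattice Fourier phases have modulus one. [folklore] -/
theorem norm_exp_phase (S : ℕ) (p y : Fin 3 → ZMod (2 * S + 1)) :
    ‖Complex.exp (-(2 * Real.pi * Complex.I *
        (∑ i : Fin 3, ((p i).val : ℂ) * ((y i).val : ℂ)) / (2 * S + 1 : ℂ)))‖ = 1 := by
  have : -(2 * Real.pi * Complex.I * (∑ i : Fin 3, ((p i).val : ℂ) * ((y i).val : ℂ)) /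
      (2 * S + 1 : ℂ)) =
      ((-(2 * Real.pi * (∑ i : Fin 3, ((p i).val : ℝ) * ((y i).val : ℝ)) / (2 * S + 1)) : ℝ) : ℂ) *
        Complex.I := by
    push_cast
    ring
  rw [this, Complex.norm_exp_ofReal_mul_I]


/-- Frobenius bound for a finite sum of unimodular multiples of norm-bounded matrices, in the
crux's `fro` form. [folklore] -/
theorem sum_norm_sq_sum_smul_le {ι : Type*} [Fintype ι] {N : ℕ} (c : ι → ℂ)
    (M : ι → Matrix (Fin N) (Fin N) ℂ) {B : ℝ} (hc : ∀ i, ‖c i‖ = 1) (hM : ∀ i, ‖M i‖ ≤ B) :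
    ∑ a, ∑ b, ‖(∑ i, c i • M i) a b‖ ^ 2 ≤ (Fintype.card ι * B) ^ 2 := by
  rw [← UnitaryCayley.frobenius_norm_sq]
  have h : ‖∑ i, c i • M i‖ ≤ Fintype.card ι * B := by
    refine (norm_sum_le _ _).trans ?_
    calc ∑ i, ‖c i • M i‖ ≤ ∑ _i, B := Finset.sum_le_sum fun i _ => by
            rw [norm_smul, hc, one_mul]; exact hM i
      _ = Fintype.card ι * B := by rw [Finset.sum_const, Finset.card_univ, nsmul_eq_mul]
  exact pow_le_pow_left₀ (norm_nonneg _) h 2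

/-- **The trivial volume bound `Dmax ≤ 3 N (2S+1)³`** on the crux's covariance scale (any compact
`G`, any `r`, `β`, `S`; `coul`, `cov`, `Dmax` verbatim from the crux). [folklore] -/
theorem dmax_le_volume (r : LatticeRep G) (β : ℝ) (S : ℕ) :
    let μ := wilsonMeasure (d := 4) (L := 2 * S + 1) r.ρ β
    let fro : Matrix (Fin r.N) (Fin r.N) ℂ → ℝ := fun M => ∑ a, ∑ b, ‖M a b‖ ^ 2
    let coul : GaugeConfig 4 (2 * S + 1) G → (Site 4 (2 * S + 1) → G) → ℝ := fun U h =>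
      -∑ e : Edge 4 (2 * S + 1),
        (if e.1 0 = 0 ∧ e.2 ≠ 0 then (r.ρ (gaugeTransform h U e)).trace.re else 0)
    let cov : GaugeConfig 4 (2 * S + 1) G → (Site 4 (2 * S + 1) → G) →
        (Fin 3 → ZMod (2 * S + 1)) → ℝ := fun U h p =>
      (∑ j : Fin 3, fro (∑ y : Fin 3 → ZMod (2 * S + 1),
        Complex.exp (-(2 * Real.pi * Complex.I *
          (∑ i : Fin 3, ((p i).val : ℂ) * ((y i).val : ℂ)) / (2 * S + 1 : ℂ))) •
        ((1 / 2 : ℂ) • (r.ρ (gaugeTransform h U (Fin.cons (0 : ZMod (2 * S + 1)) y, j.succ)) -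
          (r.ρ (gaugeTransform h U (Fin.cons (0 : ZMod (2 * S + 1)) y, j.succ)))ᴴ)))) /
        ((2 * S + 1 : ℝ) ^ 3)
    let Dmax : ℝ := ⨆ p : Fin 3 → ZMod (2 * S + 1),
      ∫ U, (⨆ h : {h : Site 4 (2 * S + 1) → G // ∀ h', coul U h ≤ coul U h'}, cov U h.1 p) ∂μ
    Dmax ≤ 3 * (r.N : ℝ) * (2 * S + 1 : ℝ) ^ 3 := by
  intro μ fro coul cov Dmax
  have hL : (0 : ℝ) < (2 * S + 1 : ℝ) := by positivity
  have hcard : (Fintype.card (Fin 3 → ZMod (2 * S + 1)) : ℝ) = (2 * S + 1 : ℝ) ^ 3 := by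
    rw [Fintype.card_fun, ZMod.card, Fintype.card_fin]; push_cast; ring
  -- pointwise bound on `cov`
  have hsq : ((2 * S + 1 : ℝ) ^ 3 * Real.sqrt r.N) ^ 2 = (r.N : ℝ) * ((2 * S + 1 : ℝ) ^ 3) ^ 2 := by
    rw [mul_pow, Real.sq_sqrt (Nat.cast_nonneg _)]; ring
  have hcov : ∀ U h p, cov U h p ≤ 3 * (r.N : ℝ) * (2 * S + 1 : ℝ) ^ 3 := by
    intro U h p
    have hj : ∀ j : Fin 3, fro (∑ y : Fin 3 → ZMod (2 * S + 1),
        Complex.exp (-(2 * Real.pi * Complex.I *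
          (∑ i : Fin 3, ((p i).val : ℂ) * ((y i).val : ℂ)) / (2 * S + 1 : ℂ))) •
        ((1 / 2 : ℂ) • (r.ρ (gaugeTransform h U (Fin.cons (0 : ZMod (2 * S + 1)) y, j.succ)) -
          (r.ρ (gaugeTransform h U (Fin.cons (0 : ZMod (2 * S + 1)) y, j.succ)))ᴴ))) ≤
        (r.N : ℝ) * ((2 * S + 1 : ℝ) ^ 3) ^ 2 := fun j => by
      have h1 := sum_norm_sq_sum_smul_le (ι := Fin 3 → ZMod (2 * S + 1))
        (fun y => Complex.exp (-(2 * Real.pi * Complex.I *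
          (∑ i : Fin 3, ((p i).val : ℂ) * ((y i).val : ℂ)) / (2 * S + 1 : ℂ))))
        (fun y => (1 / 2 : ℂ) • (r.ρ (gaugeTransform h U (Fin.cons (0 : ZMod (2 * S + 1)) y, j.succ)) -
          (r.ρ (gaugeTransform h U (Fin.cons (0 : ZMod (2 * S + 1)) y, j.succ)))ᴴ))
        (fun y => norm_exp_phase S p y) (fun y => norm_antiHermitianPart_le r _)
      rw [hcard, hsq] at h1
      exact h1
    have hsum : (∑ j : Fin 3, fro (∑ y : Fin 3 → ZMod (2 * S + 1),
        Complex.exp (-(2 * Real.pi * Complex.I *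
          (∑ i : Fin 3, ((p i).val : ℂ) * ((y i).val : ℂ)) / (2 * S + 1 : ℂ))) •
        ((1 / 2 : ℂ) • (r.ρ (gaugeTransform h U (Fin.cons (0 : ZMod (2 * S + 1)) y, j.succ)) -
          (r.ρ (gaugeTransform h U (Fin.cons (0 : ZMod (2 * S + 1)) y, j.succ)))ᴴ)))) ≤
        3 * (r.N : ℝ) * (2 * S + 1 : ℝ) ^ 3 * (2 * S + 1 : ℝ) ^ 3 :=
      calc _ ≤ ∑ _j : Fin 3, (r.N : ℝ) * ((2 * S + 1 : ℝ) ^ 3) ^ 2 :=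
            Finset.sum_le_sum fun j _ => hj j
        _ = 3 * (r.N : ℝ) * (2 * S + 1 : ℝ) ^ 3 * (2 * S + 1 : ℝ) ^ 3 := by
            rw [Finset.sum_const, Finset.card_univ, Fintype.card_fin, nsmul_eq_mul]; push_cast; ring
    exact (div_le_iff₀ (by positivity)).2 hsum
  have hcov0 : ∀ U h p, 0 ≤ cov U h p := fun U h p => by
    refine div_nonneg (Finset.sum_nonneg fun j _ => ?_) (by positivity)
    exact Finset.sum_nonneg fun a _ => Finset.sum_nonneg fun b _ => by positivity
  have hB : 0 ≤ 3 * (r.N : ℝ) * (2 * S + 1 : ℝ) ^ 3 := by positivity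
  -- `⨆ h`, `∫`, `⨆ p`
  refine Real.iSup_le (fun p => ?_) hB
  have hsup : ∀ U, (⨆ h : {h : Site 4 (2 * S + 1) → G // ∀ h', coul U h ≤ coul U h'}, cov U h.1 p) ≤
      3 * (r.N : ℝ) * (2 * S + 1 : ℝ) ^ 3 := fun U => Real.iSup_le (fun h => hcov U h.1 p) hB
  have hsup0 : ∀ U, 0 ≤ (⨆ h : {h : Site 4 (2 * S + 1) → G // ∀ h', coul U h ≤ coul U h'}, cov U h.1 p) :=
    fun U => Real.iSup_nonneg fun h => hcov0 U h.1 p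
  haveI := isProbabilityMeasure_wilsonMeasure (d := 4) (L := 2 * S + 1) r.ρ r.continuous β
  calc ∫ U, (⨆ h : {h : Site 4 (2 * S + 1) → G // ∀ h', coul U h ≤ coul U h'}, cov U h.1 p) ∂μ
      ≤ ∫ _U, 3 * (r.N : ℝ) * (2 * S + 1 : ℝ) ^ 3 ∂μ :=
        integral_mono_of_nonneg (Eventually.of_forall hsup0) (integrable_const _)
          (Eventually.of_forall hsup)
    _ = 3 * (r.N : ℝ) * (2 * S + 1 : ℝ) ^ 3 := by
        rw [integral_const, smul_eq_mul]
        simp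

end Volume

end Summit.QuantumFields.YangMills.Theorems.BrascampLiebVacuum.Negative

end
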